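import Summits.CriticalPhenomena.SAWScalingLimit.Theorems.SAWTotalPositivityBoundaryTP2Defs
import Summits.CriticalPhenomena.SAWScalingLimit.Theorems.SAWTotalPositivityBoundaryTP2Kernel
import Summits.CriticalPhenomena.SAWScalingLimit.Theorems.SAWTotalPositivityBoundaryTP2Symmetry
import Summits.CriticalPhenomena.SAWScalingLimit.Theorems.SAWTotalPositivityBoundaryTP2FirstStep
import Summits.CriticalPhenomena.SAWScalingLimit.Theorems.SAWTotalPositivityBoundaryTP2Avoid
import Summits.CriticalPhenomena.SAWScalingLimit.Theorems.SAWTotalPositivityBoundaryTP2SquareGadget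
import Summits.CriticalPhenomena.SAWScalingLimit.Theorems.SAWTotalPositivityBoundaryTP2LadderKernelsInterior
import Summits.CriticalPhenomena.SAWScalingLimit.Theorems.SAWTotalPositivityBoundaryTP2Strip3RecCornerAux
import Summits.CriticalPhenomena.SAWScalingLimit.Theorems.EdgeOfPositivity.Negative.EdgeOfPositivityRectDomain
import HarnessLib

/-!
# Crux `BoundaryTP2` (stmt-CriticalPhenomena-7115), line `Sketch`: width-4 transfer, the site next
to the corner of the last column

Tool stub `stub_strip4_recNear` of the line's skeleton (the 4-row strip programme). On the strips
`S_L = discreteDomainGraph (rectDomain L 3) 1` (sites `{0..L} × {0,1,2,3}`, lattice adjacency), with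
the rows labelled `ρ = (ρ₀,ρ₁,ρ₂,ρ₃) ∈ {(0,1,2,3), (3,2,1,0)}` (the two labellings are mirror images),
write `p_j = (L,ρ_j)`, `m_j = (L+1,ρ_j)`, `a = (0,r)`, and `Z`, `PP` for the fugacity-`x` self-avoiding
path kernel and the disjoint-pair kernel of `S_L`. The kernel of `S_{L+1}` from `a` into the site
`t = m₁` NEXT to the corner `m₀` satisfies

  `Z_{S_{L+1}}(a,t) = x² Z(a,p₀) + x Z(a,p₁) + x² Z(a,p₂) + x³ Z(a,p₃)
                      + x⁵ PP(a → p₃ ; p₀ → p₂) + x⁴ PP(a → p₃ ; p₁ → p₂)`,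

given that every `S_L`-path `a → p₂` meets every `S_L`-path `p₀ → p₃` and every `S_L`-path
`p₁ → p₃` (interlacing, supplied separately by `stub_strip4_interlaced`).

Proof: reverse the paths and take the first step at `t`, of degree three (neighbours `p₁`, `m₀`,
`m₂`; `ladderInt_firstStep_triple`). In `H = S_{L+1} - t` the corner `m₀` is a leaf hanging on `p₀`,
and in `K = H - m₀` the two remaining new sites form a domino `m₂ ∼ m₃` hanging on `p₂`, `p₃`, with
`K - m₂ - m₃ = S_L`.
* From `p₁`: delete the leaf `m₀`; the paths avoiding `m₂` are the paths of `K - m₂`, where `m₃` is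
  a leaf (term `x Z(a,p₁)`); the paths through `m₂` traverse the domino as the excursion
  `p₃ m₃ m₂ p₂` (the opposite orientation is excluded by the second interlacing hypothesis) and are
  `× x³` the disjoint pairs `(γ : a → p₃, γ' : p₂ → p₁)` — the hanging-domino identity
  `s3dom_pathKernelOn_visit` — i.e. `x⁴ PP(a → p₃ ; p₁ → p₂)` after reversing `γ'`.
* From `m₀` (a leaf of `H`): one forced step to `p₀`, then the same dichotomy: `x² Z(a,p₀)` and
  `x⁵ PP(a → p₃ ; p₀ → p₂)` (first interlacing hypothesis).
* From `m₂` (neighbours `p₂`, `m₃` in `K`): to `p₂`, after which `m₃` is a leaf (`x² Z(a,p₂)`), or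
  to the leaf `m₃` and on to `p₃` (`x³ Z(a,p₃)`).
-/

noncomputable section

namespace Summit.CriticalPhenomena.SAWScalingLimit.Theorems.BoundaryTP2

open Literature.Probability.LatticeModels Literature.Probability.RandomPlanarGeometry
open Summit.CriticalPhenomena.SAWScalingLimit.Theorems.EdgeOfPositivity.Negative
open scoped ENNReal

/-! ## Reversing one path of a disjoint pair -/

open Classical in
/-- Reversing the second path of a pair preserves lengths and disjointness of the supports, so the
disjoint-pair kernel with second paths `c → b` equals the one with second paths `b → c`.
[folklore] -/
private theorem s4n_pair_reverse {V : Type*} (R : SimpleGraph V) (x : ℝ) (a d b c : V) :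
    (∑' (γ : R.Path a d) (γ' : R.Path c b),
        (if List.Disjoint γ.1.support γ'.1.support then
          ENNReal.ofReal (x ^ γ.1.length) * ENNReal.ofReal (x ^ γ'.1.length) else 0)) =
      ∑' (γ : R.Path a d) (γ' : R.Path b c),
        (if List.Disjoint γ.1.support γ'.1.support then
          ENNReal.ofReal (x ^ γ.1.length) * ENNReal.ofReal (x ^ γ'.1.length) else 0) := by
  -- adapted from `pathKernelOn_visit_eq_tsum_arms'` (…BoundaryTP2StarArms)
  refine tsum_congr fun γ => ?_
  refine (Equiv.tsum_eq (pathReverseEquiv R b c) _).symm.trans ?_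
  refine tsum_congr fun γ' => ?_
  simp only [pathReverseEquiv, Equiv.coe_fn_mk, SimpleGraph.Walk.support_reverse,
    List.disjoint_reverse_right, SimpleGraph.Walk.length_reverse]

/-! ## Coordinates on the 4-row strip -/

/-- Adjacency in `ℤ²` in coordinates: the sites agree in one coordinate and differ by `1` in the
other (after `…BoundaryTP2LadderKernels`). [folklore] -/
private theorem s4n_zd_adj_iff (u v : Site 2) :
    (zdGraph 2).Adj u v ↔
      ((v 0 = u 0 + 1 ∨ u 0 = v 0 + 1) ∧ v 1 = u 1) ∨
        ((v 1 = u 1 + 1 ∨ u 1 = v 1 + 1) ∧ v 0 = u 0) := by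
  -- adapted from `ladder_zd_adj_iff` (…BoundaryTP2LadderKernels)
  rw [zdGraph_adj_iff, Fin.exists_fin_two]
  simp only [funext_iff, Fin.forall_fin_two, Pi.add_apply, Pi.single_eq_same,
    Pi.single_eq_of_ne (one_ne_zero : (1 : Fin 2) ≠ 0),
    Pi.single_eq_of_ne (zero_ne_one : (0 : Fin 2) ≠ 1), add_zero]
  omega

/-- A site equals `st a b` iff its two coordinates are `a` and `b`. [folklore] -/
private theorem s4n_eq_st_iff (v : Site 2) (a b : ℤ) : v = st a b ↔ v 0 = a ∧ v 1 = b := by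
  constructor
  · rintro rfl
    exact ⟨rfl, rfl⟩
  · rintro ⟨h0, h1⟩
    rw [← st_eta v, h0, h1]

/-- Adjacency of the 4-row strip `{0..a} × {0,1,2,3}` in coordinates. [folklore] -/
private theorem s4n_adj_iff (a : ℕ) (u v : Site 2) :
    (discreteDomainGraph (rectDomain a 3) 1).Adj u v ↔
      (((v 0 = u 0 + 1 ∨ u 0 = v 0 + 1) ∧ v 1 = u 1) ∨
          ((v 1 = u 1 + 1 ∨ u 1 = v 1 + 1) ∧ v 0 = u 0)) ∧
        ((0 ≤ u 0 ∧ u 0 ≤ a) ∧ (0 ≤ u 1 ∧ u 1 ≤ 3)) ∧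
          ((0 ≤ v 0 ∧ v 0 ≤ a) ∧ (0 ≤ v 1 ∧ v 1 ≤ 3)) := by
  rw [adj_rect_iff, s4n_zd_adj_iff, mem_rectSites_iff, mem_rectSites_iff, Nat.cast_ofNat]

/-! ## The last column: the site next to the corner, the corner leaf, the domino, deletion -/

/-- In `S_{L+1}` the site `t = (L+1,ρ₁)` next to the corner has exactly the three neighbours
`(L,ρ₁)`, `(L+1,ρ₀)`, `(L+1,ρ₂)`. [folklore] -/
private theorem s4n_near_neighborSet (L : ℕ) (r0 r1 r2 r3 : ℤ)
    (hρ : (r0 = 0 ∧ r1 = 1 ∧ r2 = 2 ∧ r3 = 3) ∨ (r0 = 3 ∧ r1 = 2 ∧ r2 = 1 ∧ r3 = 0)) :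
    (discreteDomainGraph (rectDomain (L + 1) 3) 1).neighborSet (st (L + 1 : ℕ) r1) =
      {st L r1, st (L + 1 : ℕ) r0, st (L + 1 : ℕ) r2} := by
  ext v
  rw [SimpleGraph.mem_neighborSet, s4n_adj_iff, Set.mem_insert_iff, Set.mem_insert_iff,
    Set.mem_singleton_iff, s4n_eq_st_iff, s4n_eq_st_iff, s4n_eq_st_iff, st_zero, st_one]
  omega

/-- In `H = S_{L+1} - t` (`t = (L+1,ρ₁)`) the corner `(L+1,ρ₀)` is a leaf hanging on `(L,ρ₀)`.
[folklore] -/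
private theorem s4n_corner_neighborSet (L : ℕ) (r0 r1 r2 r3 : ℤ)
    (hρ : (r0 = 0 ∧ r1 = 1 ∧ r2 = 2 ∧ r3 = 3) ∨ (r0 = 3 ∧ r1 = 2 ∧ r2 = 1 ∧ r3 = 0)) :
    ((discreteDomainGraph (rectDomain (L + 1) 3) 1).deleteEdges
        ((discreteDomainGraph (rectDomain (L + 1) 3) 1).incidenceSet (st (L + 1 : ℕ) r1))).neighborSet
        (st (L + 1 : ℕ) r0) = {st L r0} := by
  ext v
  rw [SimpleGraph.mem_neighborSet, deleteEdges_incidenceSet_adj, s4n_adj_iff, Set.mem_singleton_iff]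
  simp only [Ne, s4n_eq_st_iff, st_zero, st_one]
  omega

/-- In `K = S_{L+1} - t - (L+1,ρ₀)` (given through its adjacency `hK`) the site `(L+1,ρ₂)` has
exactly the neighbours `(L,ρ₂)` and `(L+1,ρ₃)`. [folklore] -/
private theorem s4n_dom_adj_iff (L : ℕ) (r0 r1 r2 r3 : ℤ)
    (hρ : (r0 = 0 ∧ r1 = 1 ∧ r2 = 2 ∧ r3 = 3) ∨ (r0 = 3 ∧ r1 = 2 ∧ r2 = 1 ∧ r3 = 0))
    {K : SimpleGraph (Site 2)}
    (hK : ∀ u v, K.Adj u v ↔ (discreteDomainGraph (rectDomain (L + 1) 3) 1).Adj u v ∧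
      (u ≠ st (L + 1 : ℕ) r1 ∧ u ≠ st (L + 1 : ℕ) r0) ∧
        (v ≠ st (L + 1 : ℕ) r1 ∧ v ≠ st (L + 1 : ℕ) r0))
    (z : Site 2) : K.Adj (st (L + 1 : ℕ) r2) z ↔ z = st L r2 ∨ z = st (L + 1 : ℕ) r3 := by
  rw [hK, s4n_adj_iff]
  simp only [Ne, s4n_eq_st_iff, st_zero, st_one]
  omega

/-- In `K = S_{L+1} - t - (L+1,ρ₀)` the far corner `(L+1,ρ₃)` has exactly the neighbours
`(L+1,ρ₂)` and `(L,ρ₃)`. [folklore] -/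
private theorem s4n_far_adj_iff (L : ℕ) (r0 r1 r2 r3 : ℤ)
    (hρ : (r0 = 0 ∧ r1 = 1 ∧ r2 = 2 ∧ r3 = 3) ∨ (r0 = 3 ∧ r1 = 2 ∧ r2 = 1 ∧ r3 = 0))
    {K : SimpleGraph (Site 2)}
    (hK : ∀ u v, K.Adj u v ↔ (discreteDomainGraph (rectDomain (L + 1) 3) 1).Adj u v ∧
      (u ≠ st (L + 1 : ℕ) r1 ∧ u ≠ st (L + 1 : ℕ) r0) ∧
        (v ≠ st (L + 1 : ℕ) r1 ∧ v ≠ st (L + 1 : ℕ) r0))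
    (z : Site 2) : K.Adj (st (L + 1 : ℕ) r3) z ↔ z = st (L + 1 : ℕ) r2 ∨ z = st L r3 := by
  rw [hK, s4n_adj_iff]
  simp only [Ne, s4n_eq_st_iff, st_zero, st_one]
  omega

/-- Deleting the whole last column of `S_{L+1}` leaves `S_L`: `K - (L+1,ρ₂) - (L+1,ρ₃) = S_L` as
simple graphs on `Site 2`, for `K = S_{L+1} - t - (L+1,ρ₀)`. [folklore] -/
private theorem s4n_delete_lastColumn (L : ℕ) (r0 r1 r2 r3 : ℤ)
    (hρ : (r0 = 0 ∧ r1 = 1 ∧ r2 = 2 ∧ r3 = 3) ∨ (r0 = 3 ∧ r1 = 2 ∧ r2 = 1 ∧ r3 = 0))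
    {K : SimpleGraph (Site 2)}
    (hK : ∀ u v, K.Adj u v ↔ (discreteDomainGraph (rectDomain (L + 1) 3) 1).Adj u v ∧
      (u ≠ st (L + 1 : ℕ) r1 ∧ u ≠ st (L + 1 : ℕ) r0) ∧
        (v ≠ st (L + 1 : ℕ) r1 ∧ v ≠ st (L + 1 : ℕ) r0)) :
    (K.deleteEdges (K.incidenceSet (st (L + 1 : ℕ) r2))).deleteEdges
        ((K.deleteEdges (K.incidenceSet (st (L + 1 : ℕ) r2))).incidenceSet (st (L + 1 : ℕ) r3)) =
      discreteDomainGraph (rectDomain L 3) 1 := by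
  -- adapted from `ladder_delete_lastColumn` (…BoundaryTP2LadderKernels)
  ext u v
  rw [deleteEdges_incidenceSet_adj, deleteEdges_incidenceSet_adj, hK, adj_rect_iff, adj_rect_iff]
  constructor
  · rintro ⟨⟨⟨⟨hzd, hu, hv⟩, ⟨hut, hu0⟩, ⟨hvt, hv0⟩⟩, hu2, hv2⟩, hu3, hv3⟩
    rw [mem_rectSites_iff] at hu hv
    rw [Ne, s4n_eq_st_iff] at hut hu0 hvt hv0 hu2 hv2 hu3 hv3
    refine ⟨hzd, ?_, ?_⟩
    · clear hvt hv0 hv2 hv3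
      rw [mem_rectSites_iff]; omega
    · clear hut hu0 hu2 hu3
      rw [mem_rectSites_iff]; omega
  · rintro ⟨hzd, hu, hv⟩
    rw [mem_rectSites_iff] at hu hv
    refine ⟨⟨⟨⟨hzd, ?_, ?_⟩, ⟨?_, ?_⟩, ⟨?_, ?_⟩⟩, ?_, ?_⟩, ?_, ?_⟩
    · rw [mem_rectSites_iff]; omega
    · rw [mem_rectSites_iff]; omega
    all_goals rw [Ne, s4n_eq_st_iff]; omega

/-! ## The recursion -/

open Classical in
/-- STUB W4-C2 (`stub_strip4_recNear`). Width-4 last-column recursion for the kernel to the site `(L+1,ρ₁)` NEXT to the corner `ρ₀`: four one-crossing terms and two three-crossing terms. [folklore] -/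
theorem stub_strip4_recNear (L : ℕ) {x : ℝ} (hx : 0 ≤ x) (r : ℤ) (hr : 0 ≤ r ∧ r ≤ 3) (r0 r1 r2 r3 : ℤ)
    (hρ : (r0 = 0 ∧ r1 = 1 ∧ r2 = 2 ∧ r3 = 3) ∨ (r0 = 3 ∧ r1 = 2 ∧ r2 = 1 ∧ r3 = 0))
    (hI1 : Interlaced (discreteDomainGraph (rectDomain L 3) 1) (st 0 r) (st L r0) (st L r2) (st L r3))
    (hI2 : Interlaced (discreteDomainGraph (rectDomain L 3) 1) (st 0 r) (st L r1) (st L r2) (st L r3)) :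
    pathKernel (discreteDomainGraph (rectDomain (L + 1) 3) 1) x (st 0 r) (st (L + 1 : ℕ) r1) =
      ENNReal.ofReal (x ^ 2) * pathKernel (discreteDomainGraph (rectDomain L 3) 1) x (st 0 r) (st L r0) +
        ENNReal.ofReal x * pathKernel (discreteDomainGraph (rectDomain L 3) 1) x (st 0 r) (st L r1) +
        ENNReal.ofReal (x ^ 2) * pathKernel (discreteDomainGraph (rectDomain L 3) 1) x (st 0 r) (st L r2) +
        ENNReal.ofReal (x ^ 3) * pathKernel (discreteDomainGraph (rectDomain L 3) 1) x (st 0 r) (st L r3) +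
        ENNReal.ofReal (x ^ 5) *
          (∑' (γ : (discreteDomainGraph (rectDomain L 3) 1).Path (st 0 r) (st L r3))
              (γ' : (discreteDomainGraph (rectDomain L 3) 1).Path (st L r0) (st L r2)),
            (if List.Disjoint γ.1.support γ'.1.support then
              ENNReal.ofReal (x ^ γ.1.length) * ENNReal.ofReal (x ^ γ'.1.length) else 0)) +
        ENNReal.ofReal (x ^ 4) *
          (∑' (γ : (discreteDomainGraph (rectDomain L 3) 1).Path (st 0 r) (st L r3))
              (γ' : (discreteDomainGraph (rectDomain L 3) 1).Path (st L r1) (st L r2)),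
            (if List.Disjoint γ.1.support γ'.1.support then
              ENNReal.ofReal (x ^ γ.1.length) * ENNReal.ofReal (x ^ γ'.1.length) else 0)) := by
  obtain ⟨-, -⟩ := hr -- the row constraint on the start is not needed
  -- distinctness of the sites involved (columns `0`, `L` versus `L + 1`; distinct rows)
  have hta : st (L + 1 : ℕ) r1 ≠ st 0 r := by
    rw [Ne, s4n_eq_st_iff, st_zero, st_one]; omega
  have h12 : st (L : ℤ) r1 ≠ st (L + 1 : ℕ) r0 := by
    rw [Ne, s4n_eq_st_iff, st_zero, st_one]; omega
  have h13 : st (L : ℤ) r1 ≠ st (L + 1 : ℕ) r2 := by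
    rw [Ne, s4n_eq_st_iff, st_zero, st_one]; omega
  have h23 : st (L + 1 : ℕ) r0 ≠ st (L + 1 : ℕ) r2 := by
    rw [Ne, s4n_eq_st_iff, st_zero, st_one]; omega
  have ham0 : st 0 r ≠ st (L + 1 : ℕ) r0 := by
    rw [Ne, s4n_eq_st_iff, st_zero, st_one]; omega
  have ham2 : st 0 r ≠ st (L + 1 : ℕ) r2 := by
    rw [Ne, s4n_eq_st_iff, st_zero, st_one]; omega
  have ham3 : st 0 r ≠ st (L + 1 : ℕ) r3 := by
    rw [Ne, s4n_eq_st_iff, st_zero, st_one]; omega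
  have h1m3 : st (L : ℤ) r1 ≠ st (L + 1 : ℕ) r3 := by
    rw [Ne, s4n_eq_st_iff, st_zero, st_one]; omega
  have h0m2 : st (L : ℤ) r0 ≠ st (L + 1 : ℕ) r2 := by
    rw [Ne, s4n_eq_st_iff, st_zero, st_one]; omega
  have h0m3 : st (L : ℤ) r0 ≠ st (L + 1 : ℕ) r3 := by
    rw [Ne, s4n_eq_st_iff, st_zero, st_one]; omega
  have h2m3 : st (L : ℤ) r2 ≠ st (L + 1 : ℕ) r3 := by
    rw [Ne, s4n_eq_st_iff, st_zero, st_one]; omega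
  set S := discreteDomainGraph (rectDomain (L + 1) 3) 1
  set R := discreteDomainGraph (rectDomain L 3) 1
  -- first step at `t = (L+1, ρ₁)` of the reversed paths (degree three)
  rw [pathKernel_comm S x (st 0 r) (st (L + 1 : ℕ) r1),
    ladderInt_firstStep_triple S x hx hta h12 h13 h23 (s4n_near_neighborSet L r0 r1 r2 r3 hρ)]
  set H := S.deleteEdges (S.incidenceSet (st (L + 1 : ℕ) r1)) with hH
  -- the corner `m₀ = (L+1, ρ₀)` is a leaf of `H`, hanging on `p₀ = (L, ρ₀)`
  have hN0 : H.neighborSet (st (L + 1 : ℕ) r0) = {st (L : ℤ) r0} :=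
    s4n_corner_neighborSet L r0 r1 r2 r3 hρ
  have hleaf0 : ∀ z, H.Adj (st (L + 1 : ℕ) r0) z → z = st L r0 := fun z hz => by
    have hz' : z ∈ H.neighborSet (st (L + 1 : ℕ) r0) := hz
    rwa [hN0, Set.mem_singleton_iff] at hz'
  -- branches `p₁`, `m₂`: delete the leaf `m₀`; branch `m₀`: the forced step to `p₀`
  rw [pathKernel_eq_deleteVert_of_leaf H x hleaf0 h12 ham0,
    pathKernel_eq_deleteVert_of_leaf H x hleaf0 h23.symm ham0,
    pathKernel_firstStep_single H x hx ham0.symm hN0]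
  set K := H.deleteEdges (H.incidenceSet (st (L + 1 : ℕ) r0)) with hK
  have hKadj : ∀ u v, K.Adj u v ↔ S.Adj u v ∧
      (u ≠ st (L + 1 : ℕ) r1 ∧ u ≠ st (L + 1 : ℕ) r0) ∧
        (v ≠ st (L + 1 : ℕ) r1 ∧ v ≠ st (L + 1 : ℕ) r0) := by
    intro u v
    rw [hK, deleteEdges_incidenceSet_adj, hH, deleteEdges_incidenceSet_adj]
    tauto
  -- the domino `m₂ = (L+1, ρ₂) ∼ m₃ = (L+1, ρ₃)` of `K`, hanging on `p₂`, `p₃`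
  have hNm : ∀ z, K.Adj (st (L + 1 : ℕ) r2) z ↔ z = st L r2 ∨ z = st (L + 1 : ℕ) r3 :=
    s4n_dom_adj_iff L r0 r1 r2 r3 hρ hKadj
  have hNn : ∀ z, K.Adj (st (L + 1 : ℕ) r3) z ↔ z = st (L + 1 : ℕ) r2 ∨ z = st L r3 :=
    s4n_far_adj_iff L r0 r1 r2 r3 hρ hKadj
  have hNm' : K.neighborSet (st (L + 1 : ℕ) r2) = {st (L : ℤ) r2, st (L + 1 : ℕ) r3} := by
    ext z
    rw [SimpleGraph.mem_neighborSet, hNm z, Set.mem_insert_iff, Set.mem_singleton_iff]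
  -- branch `m₂`: first step at `m₂`; branches `p₁`, `m₀`: split according to visiting `m₂`
  rw [pathKernel_firstStep_pair K x hx ham2.symm h2m3 hNm',
    pathKernel_comm K x (st (L : ℤ) r1) (st 0 r),
    ← pathKernelOn_add_compl x (st 0 r) (st (L : ℤ) r1)
      {γ : K.Path (st 0 r) (st (L : ℤ) r1) | st (L + 1 : ℕ) r2 ∉ γ.1.support},
    stub_pathKernelOn_avoid K x _ _ _ ham2 h13,
    pathKernel_comm K x (st (L : ℤ) r0) (st 0 r),
    ← pathKernelOn_add_compl x (st 0 r) (st (L : ℤ) r0)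
      {γ : K.Path (st 0 r) (st (L : ℤ) r0) | st (L + 1 : ℕ) r2 ∉ γ.1.support},
    stub_pathKernelOn_avoid K x _ _ _ ham2 h0m2]
  set K₂ := K.deleteEdges (K.incidenceSet (st (L + 1 : ℕ) r2)) with hK₂
  -- in `K₂ = K - m₂` the far corner `m₃` is a leaf hanging on `p₃`, and `K₂ - m₃ = S_L`
  have hN3 : K₂.neighborSet (st (L + 1 : ℕ) r3) = {st (L : ℤ) r3} := by
    ext z
    rw [SimpleGraph.mem_neighborSet, hK₂, deleteEdges_incidenceSet_adj, hNn z, Set.mem_singleton_iff]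
    simp only [Ne, s4n_eq_st_iff, st_zero, st_one]
    omega
  have hleaf3 : ∀ z, K₂.Adj (st (L + 1 : ℕ) r3) z → z = st L r3 := fun z hz => by
    have hz' : z ∈ K₂.neighborSet (st (L + 1 : ℕ) r3) := hz
    rwa [hN3, Set.mem_singleton_iff] at hz'
  have hKR : K₂.deleteEdges (K₂.incidenceSet (st (L + 1 : ℕ) r3)) = R :=
    s4n_delete_lastColumn L r0 r1 r2 r3 hρ hKadj
  have hRK : ∀ u v, R.Adj u v ↔
      K.Adj u v ∧ (u ≠ st (L + 1 : ℕ) r2 ∧ u ≠ st (L + 1 : ℕ) r3) ∧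
        (v ≠ st (L + 1 : ℕ) r2 ∧ v ≠ st (L + 1 : ℕ) r3) := by
    intro u v
    rw [← hKR, deleteEdges_incidenceSet_adj, hK₂, deleteEdges_incidenceSet_adj]
    tauto
  rw [pathKernel_eq_deleteVert_of_leaf K₂ x hleaf3 ham3 h1m3,
    pathKernel_eq_deleteVert_of_leaf K₂ x hleaf3 ham3 h0m3,
    pathKernel_eq_deleteVert_of_leaf K₂ x hleaf3 h2m3 ham3,
    pathKernel_firstStep_single K₂ x hx ham3.symm hN3, hKR]
  -- the paths through `m₂` traverse the domino: the hanging-domino identity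
  have hc1 : {γ : K.Path (st 0 r) (st (L : ℤ) r1) | st (L + 1 : ℕ) r2 ∉ γ.1.support}ᶜ =
      {γ | st (L + 1 : ℕ) r2 ∈ γ.1.support} := by
    rw [Set.compl_setOf]
    simp only [not_not]
  have hc0 : {γ : K.Path (st 0 r) (st (L : ℤ) r0) | st (L + 1 : ℕ) r2 ∉ γ.1.support}ᶜ =
      {γ | st (L + 1 : ℕ) r2 ∈ γ.1.support} := by
    rw [Set.compl_setOf]
    simp only [not_not]
  rw [hc1, hc0,
    s3dom_pathKernelOn_visit K R x hx hRK hNm hNn ham2 ham3 h13 h1m3 h2m3 hI2.reverse_right,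
    s3dom_pathKernelOn_visit K R x hx hRK hNm hNn ham2 ham3 h0m2 h0m3 h2m3 hI1.reverse_right,
    s4n_pair_reverse R x (st 0 r) (st (L : ℤ) r3) (st (L : ℤ) r1) (st (L : ℤ) r2),
    s4n_pair_reverse R x (st 0 r) (st (L : ℤ) r3) (st (L : ℤ) r0) (st (L : ℤ) r2)]
  -- back to paths from `(0,r)` and bookkeeping in `ℝ≥0∞`
  rw [pathKernel_comm R x (st (L : ℤ) r2) (st 0 r), pathKernel_comm R x (st (L : ℤ) r3) (st 0 r),
    ENNReal.ofReal_pow hx, ENNReal.ofReal_pow hx, ENNReal.ofReal_pow hx, ENNReal.ofReal_pow hx]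
  ring

end Summit.CriticalPhenomena.SAWScalingLimit.Theorems.BoundaryTP2
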